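import Mathlib.LinearAlgebra.Matrix.Charpoly.Coeff
import Mathlib.LinearAlgebra.Matrix.Nondegenerate
import Literature.Computability.AlgebraicComplexity.LMR13FirstOrderIdentity
import HarnessLib

/-!
# First-order calculus of the adjugate on odd skew-symmetric matrices (infrastructure for LMR13 §3.5)

[topic Computability/AlgebraicComplexity]

Landsberg–Manivel–Ressayre 2013, §3.5 (journal p. 481; arXiv:1004.4802 `p0008.txt:L74–94`) compute the
stabiliser of the boundary form `P_Λ(A + S) = (1/n)·tr(adj(A)·S)` (`pLambda`, `LMR13DualVarieties.lean`;
`aeval_pLambda_skew_add_sym`, `LMR13BoundaryFormHessian.lean`) inside `𝔤𝔩(M_n)`: "one can check that the modules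
`EA, ES, EAS, ESA` are not contained in the stabilizer, and that the contribution of the remaining terms is
isomorphic with `𝔤𝔩_n ⊕ 𝔤𝔩_n`. In particular it has dimension `2n²`". The tree has the lower bound
(`finrank_glAnn_pLambda_ge`, `LMR13StabilizerDimensions.lean`) and reduces `LMR2013_prop_3_5_1` to the upper bound
`finrank glAnn (pLambda n) ≤ 2n² − 1` (`LMR2013_prop_3_5_1_of_finrank_glAnn_le`, `LMR13BoundaryMaximality.lean`).

This file is the matrix calculus that an ELEMENTARY proof of that upper bound consumes (cell val-lit, memo
`HOME/lmr/X3b-ELEMENTARY-ROUTE-t10g4.md`, §1): the `t¹`-coefficient `D(A,B)` of `adj(A + tB)` and its properties on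
ODD skew-symmetric matrices, where `det ≡ 0` makes `adj(M)·M = 0` and hence

* `adjDeriv_mul_add_adjugate_mul` / `mul_adjDeriv_add_mul_adjugate` — `D(A,B)·A + adj(A)·B = ([t¹]det(A+tB))·1`
  (any square `A, B`), and for odd skew `A, B`: `D(A,B)·A = −adj(A)·B`, `A·D(A,B) = −B·adj(A)`
  (`adjDeriv_mul_eq_neg`, `mul_adjDeriv_eq_neg`);
* `det_eq_zero_of_transpose_eq_neg`, `adjugate_transpose_eq_of_transpose_eq_neg`, `adjDeriv_transpose` — odd skew
  matrices have zero determinant, symmetric adjugate and symmetric `D(A,B)`;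
* `padAt r Ω` — the skew matrix `Ω` of size `m` placed on the indices `≠ r` of `Fin (m+1)` (the sparse corank-one
  points `R_r(Ω)` of the memo), `submatrix_padAt`, `padAt_apply_left/right`, `adjugate_padAt`
  (`adj(R_r Ω) = det Ω · E_rr`), `adjDeriv_padAt_apply_self` (JACOBI: `D(R_r Ω, B)_{rr} = det Ω · tr(Ω⁻¹ B^{(r)})`),
  `adjDeriv_padAt_apply_of_ne` (`D(R_r Ω, B)_{ik} = 0` for `i, k ≠ r`) and `adjDeriv_padAt_row_vecMul`
  (`D(R_rΩ,B)_{r,·}·Ω = −det Ω · B_{r,·}` off `r`).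

Everything is PROVED; no named fact. Honest framing: infrastructure only; `LMR2013_prop_3_5_1` remains OPEN in the
tree; VP ≠ VNP is NOT proved and nothing here is progress on it.

## References

* [LandsbergManivelRessayre2013] J. M. Landsberg, L. Manivel, N. Ressayre, *Hypersurfaces with degenerate duals and
  the geometric complexity theory program*, Comment. Math. Helv. 88 (2013) 469–484, §3.5 (p. 481).
-/

noncomputable section

open Matrix

namespace Literature.Computability.AlgebraicComplexity

namespace SkewAdj

universe u

variable {ι : Type u}

/-! ### The line `A + tB` and the `t¹`-coefficient of its adjugate -/

/-- The line `A + t·B` of matrices, with entries in `ℂ[t]`. [cite: LandsbergManivelRessayre2013, §3.5 (p. 481)] -/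
def lineMat (A B : Matrix ι ι ℂ) : Matrix ι ι (Polynomial ℂ) :=
  A.map (Polynomial.C : ℂ →+* Polynomial ℂ) +
    (Polynomial.X : Polynomial ℂ) • B.map (Polynomial.C : ℂ →+* Polynomial ℂ)

/-- Entries of the line. [cite: LandsbergManivelRessayre2013, §3.5 (p. 481)] -/
theorem lineMat_apply (A B : Matrix ι ι ℂ) (i j : ι) :
    lineMat A B i j = Polynomial.C (A i j) + Polynomial.X * Polynomial.C (B i j) := by
  simp [lineMat, Matrix.add_apply, Matrix.smul_apply, Matrix.map_apply, smul_eq_mul]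

/-- `t⁰`-coefficients of the line. [cite: LandsbergManivelRessayre2013, §3.5 (p. 481)] -/
theorem coeff_zero_lineMat_apply (A B : Matrix ι ι ℂ) (i j : ι) : (lineMat A B i j).coeff 0 = A i j := by
  rw [lineMat_apply, Polynomial.coeff_add, Polynomial.coeff_C_zero, Polynomial.coeff_X_mul_zero, add_zero]

/-- `t¹`-coefficients of the line. [cite: LandsbergManivelRessayre2013, §3.5 (p. 481)] -/
theorem coeff_one_lineMat_apply (A B : Matrix ι ι ℂ) (i j : ι) : (lineMat A B i j).coeff 1 = B i j := by
  rw [lineMat_apply, Polynomial.coeff_add, Polynomial.coeff_C, if_neg one_ne_zero, zero_add,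
    Polynomial.coeff_X_mul, Polynomial.coeff_C_zero]

/-- The line at `t = 0` is `A`. [cite: LandsbergManivelRessayre2013, §3.5 (p. 481)] -/
theorem map_eval_zero_lineMat (A B : Matrix ι ι ℂ) :
    (lineMat A B).map (Polynomial.evalRingHom 0) = A := by
  ext i j
  rw [Matrix.map_apply, Polynomial.coe_evalRingHom, ← Polynomial.coeff_zero_eq_eval_zero,
    coeff_zero_lineMat_apply]

/-- Transpose of the line. [cite: LandsbergManivelRessayre2013, §3.5 (p. 481)] -/
theorem lineMat_transpose (A B : Matrix ι ι ℂ) : (lineMat A B)ᵀ = lineMat Aᵀ Bᵀ := by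
  ext i j
  simp [lineMat_apply]

/-- Negation of the line. [cite: LandsbergManivelRessayre2013, §3.5 (p. 481)] -/
theorem lineMat_neg (A B : Matrix ι ι ℂ) : lineMat (-A) (-B) = -lineMat A B := by
  ext i j
  simp [lineMat_apply]
  ring

variable [Fintype ι] [DecidableEq ι]

/-- **`D(A,B) := [t¹] adj(A + tB)`**, the derivative of the adjugate at `A` in the direction `B` (the first-order
term used throughout LMR 2013 §3.5's stabiliser computation for `P_Λ = (1/n)tr(adj(A)S)`).
[cite: LandsbergManivelRessayre2013, §3.5 (p. 481)] -/
def adjDeriv (A B : Matrix ι ι ℂ) : Matrix ι ι ℂ :=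
  (lineMat A B).adjugate.map fun p => p.coeff 1

/-- Unfolding `adjDeriv`. [cite: LandsbergManivelRessayre2013, §3.5 (p. 481)] -/
theorem adjDeriv_apply (A B : Matrix ι ι ℂ) (i j : ι) :
    adjDeriv A B i j = ((lineMat A B).adjugate i j).coeff 1 := rfl

/-- `[t⁰] adj(A + tB) = adj A`. [cite: LandsbergManivelRessayre2013, §3.5 (p. 481)] -/
theorem coeff_zero_adjugate_lineMat (A B : Matrix ι ι ℂ) (i j : ι) :
    ((lineMat A B).adjugate i j).coeff 0 = A.adjugate i j := by
  rw [Polynomial.coeff_zero_eq_eval_zero, ← Polynomial.coe_evalRingHom]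
  change ((Polynomial.evalRingHom 0).mapMatrix (lineMat A B).adjugate) i j = _
  rw [RingHom.map_adjugate, RingHom.mapMatrix_apply, map_eval_zero_lineMat]

/-- `[t¹]` of a product with an entry of the line. [cite: LandsbergManivelRessayre2013, §3.5 (p. 481)] -/
theorem coeff_one_mul_C_add_X_mul_C (p : Polynomial ℂ) (a b : ℂ) :
    (p * (Polynomial.C a + Polynomial.X * Polynomial.C b)).coeff 1 = p.coeff 1 * a + p.coeff 0 * b := by
  rw [mul_add, Polynomial.coeff_add, Polynomial.coeff_mul_C, ← mul_assoc, Polynomial.coeff_mul_C,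
    Polynomial.coeff_mul_X]

/-- `[t¹]` of a product with an entry of the line, other order. [cite: LandsbergManivelRessayre2013, §3.5 (p. 481)] -/
theorem coeff_one_C_add_X_mul_C_mul (p : Polynomial ℂ) (a b : ℂ) :
    ((Polynomial.C a + Polynomial.X * Polynomial.C b) * p).coeff 1 = a * p.coeff 1 + b * p.coeff 0 := by
  rw [mul_comm, coeff_one_mul_C_add_X_mul_C]
  ring

/-- **`D(A,B)·A + adj(A)·B = ([t¹] det(A + tB))·1`** — the `t¹`-coefficient of `adj(M)·M = det(M)·1` along the line.
[cite: LandsbergManivelRessayre2013, §3.5 (p. 481)] -/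
theorem adjDeriv_mul_add_adjugate_mul (A B : Matrix ι ι ℂ) :
    adjDeriv A B * A + A.adjugate * B = ((lineMat A B).det.coeff 1) • (1 : Matrix ι ι ℂ) := by
  have h := Matrix.adjugate_mul (lineMat A B)
  ext i j
  have hij : (((lineMat A B).adjugate * lineMat A B) i j).coeff 1 =
      (((lineMat A B).det • (1 : Matrix ι ι (Polynomial ℂ))) i j).coeff 1 := by rw [h]
  rw [Matrix.mul_apply, Polynomial.finsetSum_coeff] at hij
  simp_rw [lineMat_apply, coeff_one_mul_C_add_X_mul_C, coeff_zero_adjugate_lineMat] at hij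
  rw [Finset.sum_add_distrib] at hij
  rw [Matrix.add_apply, Matrix.mul_apply, Matrix.mul_apply, Matrix.smul_apply, Matrix.one_apply]
  simp_rw [adjDeriv_apply]
  rw [hij, Matrix.smul_apply, Matrix.one_apply]
  split_ifs <;> simp

/-- **`A·D(A,B) + B·adj(A) = ([t¹] det(A + tB))·1`** — the `t¹`-coefficient of `M·adj(M) = det(M)·1` along the line.
[cite: LandsbergManivelRessayre2013, §3.5 (p. 481)] -/
theorem mul_adjDeriv_add_mul_adjugate (A B : Matrix ι ι ℂ) :
    A * adjDeriv A B + B * A.adjugate = ((lineMat A B).det.coeff 1) • (1 : Matrix ι ι ℂ) := by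
  have h := Matrix.mul_adjugate (lineMat A B)
  ext i j
  have hij : ((lineMat A B * (lineMat A B).adjugate) i j).coeff 1 =
      (((lineMat A B).det • (1 : Matrix ι ι (Polynomial ℂ))) i j).coeff 1 := by rw [h]
  rw [Matrix.mul_apply, Polynomial.finsetSum_coeff] at hij
  simp_rw [lineMat_apply, coeff_one_C_add_X_mul_C_mul, coeff_zero_adjugate_lineMat] at hij
  rw [Finset.sum_add_distrib] at hij
  rw [Matrix.add_apply, Matrix.mul_apply, Matrix.mul_apply, Matrix.smul_apply, Matrix.one_apply]
  simp_rw [adjDeriv_apply]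
  rw [hij, Matrix.smul_apply, Matrix.one_apply]
  split_ifs <;> simp

/-! ### Odd skew-symmetric matrices: `det = 0`, symmetric adjugate, symmetric `D(A,B)` -/

/-- An odd-size skew-symmetric matrix over a commutative domain of characteristic zero has determinant `0`
(LMR 2013 §3.5: "the determinant of a skew-symmetric matrix of odd size vanishes", arXiv `p0008.txt:L67–68`).
[cite: LandsbergManivelRessayre2013, §3.5 (p. 481)] -/
theorem det_eq_zero_of_transpose_eq_neg {R : Type*} [CommRing R] [IsDomain R] [CharZero R]
    (hι : Odd (Fintype.card ι)) {M : Matrix ι ι R} (hM : Mᵀ = -M) : M.det = 0 := by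
  have h1 : M.det = -M.det := by
    conv_lhs => rw [← Matrix.det_transpose, hM, Matrix.det_neg, hι.neg_one_pow, neg_one_mul]
  have h2 : (2 : R) * M.det = 0 := by linear_combination h1
  exact (mul_eq_zero.1 h2).resolve_left two_ne_zero

/-- The adjugate of an odd-size skew-symmetric matrix is symmetric. [cite: LandsbergManivelRessayre2013, §3.5 (p. 481)] -/
theorem adjugate_transpose_eq_of_transpose_eq_neg {R : Type*} [CommRing R] (hι : Odd (Fintype.card ι))
    {M : Matrix ι ι R} (hM : Mᵀ = -M) : M.adjugateᵀ = M.adjugate := by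
  rw [Matrix.adjugate_transpose, hM, show -M = (-1 : R) • M by simp, Matrix.adjugate_smul,
    (Nat.Odd.sub_odd hι odd_one).neg_one_pow, one_smul]

omit [Fintype ι] [DecidableEq ι] in
/-- Along a line of skew matrices the line is skew. [cite: LandsbergManivelRessayre2013, §3.5 (p. 481)] -/
theorem lineMat_transpose_of_skew {A B : Matrix ι ι ℂ} (hA : Aᵀ = -A) (hB : Bᵀ = -B) :
    (lineMat A B)ᵀ = -lineMat A B := by
  rw [lineMat_transpose, hA, hB, lineMat_neg]

/-- **`D(A,B)·A = −adj(A)·B`** for odd-size skew-symmetric `A, B` (since `det(A + tB) ≡ 0`).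
[cite: LandsbergManivelRessayre2013, §3.5 (p. 481)] -/
theorem adjDeriv_mul_eq_neg (hι : Odd (Fintype.card ι)) {A B : Matrix ι ι ℂ} (hA : Aᵀ = -A) (hB : Bᵀ = -B) :
    adjDeriv A B * A = -(A.adjugate * B) := by
  have h := adjDeriv_mul_add_adjugate_mul A B
  rw [det_eq_zero_of_transpose_eq_neg hι (lineMat_transpose_of_skew hA hB), Polynomial.coeff_zero,
    zero_smul] at h
  exact eq_neg_of_add_eq_zero_left h

/-- **`A·D(A,B) = −B·adj(A)`** for odd-size skew-symmetric `A, B`. [cite: LandsbergManivelRessayre2013, §3.5 (p. 481)] -/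
theorem mul_adjDeriv_eq_neg (hι : Odd (Fintype.card ι)) {A B : Matrix ι ι ℂ} (hA : Aᵀ = -A) (hB : Bᵀ = -B) :
    A * adjDeriv A B = -(B * A.adjugate) := by
  have h := mul_adjDeriv_add_mul_adjugate A B
  rw [det_eq_zero_of_transpose_eq_neg hι (lineMat_transpose_of_skew hA hB), Polynomial.coeff_zero,
    zero_smul] at h
  exact eq_neg_of_add_eq_zero_left h

/-- `D(A,B)` is symmetric for odd-size skew-symmetric `A, B`. [cite: LandsbergManivelRessayre2013, §3.5 (p. 481)] -/
theorem adjDeriv_transpose (hι : Odd (Fintype.card ι)) {A B : Matrix ι ι ℂ} (hA : Aᵀ = -A) (hB : Bᵀ = -B) :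
    (adjDeriv A B)ᵀ = adjDeriv A B := by
  have h := adjugate_transpose_eq_of_transpose_eq_neg (R := Polynomial ℂ) hι (lineMat_transpose_of_skew hA hB)
  ext i j
  rw [Matrix.transpose_apply, adjDeriv_apply, adjDeriv_apply, ← Matrix.transpose_apply (M := (lineMat A B).adjugate) j i,
    h]

/-- The adjugate of an odd-size skew-symmetric complex matrix is symmetric. [cite: LandsbergManivelRessayre2013, §3.5 (p. 481)] -/
theorem adjugate_transpose_eq (hι : Odd (Fintype.card ι)) {A : Matrix ι ι ℂ} (hA : Aᵀ = -A) :
    A.adjugateᵀ = A.adjugate :=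
  adjugate_transpose_eq_of_transpose_eq_neg hι hA

end SkewAdj

/-! ### The sparse corank-one points `R_r(Ω)`: `Ω` placed on the indices `≠ r` -/

namespace SkewAdj

variable {m : ℕ}

/-- **`R_r(Ω)`**: the `(m+1) × (m+1)` matrix with zero `r`-th row and column whose restriction to the indices
`≠ r` (through `r.succAbove`) is `Ω` — the sparse corank-one test points of the elementary route (for `Ω` a signed
perfect-matching matrix these are LMR's matrices `w` of rank `n − 1` adapted to coordinates).
[cite: LandsbergManivelRessayre2013, §3.5 (p. 481)] -/
def padAt {R : Type*} [Zero R] (r : Fin (m + 1)) (Ω : Matrix (Fin m) (Fin m) R) :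
    Matrix (Fin (m + 1)) (Fin (m + 1)) R :=
  Matrix.of (Fin.insertNth (α := fun _ => Fin (m + 1) → R) r 0 fun i =>
    Fin.insertNth (α := fun _ => R) r 0 (Ω i))

variable {R : Type*} [CommRing R]

/-- Row `r` of `R_r(Ω)` vanishes. [cite: LandsbergManivelRessayre2013, §3.5 (p. 481)] -/
@[simp]
theorem padAt_apply_left (r : Fin (m + 1)) (Ω : Matrix (Fin m) (Fin m) R) (j : Fin (m + 1)) :
    padAt r Ω r j = 0 := by
  simp [padAt, Fin.insertNth_apply_same]

/-- Column `r` of `R_r(Ω)` vanishes. [cite: LandsbergManivelRessayre2013, §3.5 (p. 481)] -/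
@[simp]
theorem padAt_apply_right (r : Fin (m + 1)) (Ω : Matrix (Fin m) (Fin m) R) (i : Fin (m + 1)) :
    padAt r Ω i r = 0 := by
  rcases Fin.eq_self_or_eq_succAbove r i with rfl | ⟨i', rfl⟩
  · simp [padAt, Fin.insertNth_apply_same]
  · simp [padAt, Fin.insertNth_apply_succAbove, Fin.insertNth_apply_same]

/-- The entries of `R_r(Ω)` off `r`. [cite: LandsbergManivelRessayre2013, §3.5 (p. 481)] -/
@[simp]
theorem padAt_apply_succAbove (r : Fin (m + 1)) (Ω : Matrix (Fin m) (Fin m) R) (i j : Fin m) :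
    padAt r Ω (r.succAbove i) (r.succAbove j) = Ω i j := by
  simp [padAt, Fin.insertNth_apply_succAbove]

/-- `R_r(Ω)` restricted to the indices `≠ r` is `Ω`. [cite: LandsbergManivelRessayre2013, §3.5 (p. 481)] -/
theorem submatrix_padAt (r : Fin (m + 1)) (Ω : Matrix (Fin m) (Fin m) R) :
    (padAt r Ω).submatrix r.succAbove r.succAbove = Ω := by
  ext i j
  simp

/-- `R_r(Ω)` is skew when `Ω` is. [cite: LandsbergManivelRessayre2013, §3.5 (p. 481)] -/
theorem padAt_transpose (r : Fin (m + 1)) (Ω : Matrix (Fin m) (Fin m) R) :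
    (padAt r Ω)ᵀ = padAt r Ωᵀ := by
  ext i j
  rcases Fin.eq_self_or_eq_succAbove r i with rfl | ⟨i', rfl⟩
  · simp
  · rcases Fin.eq_self_or_eq_succAbove r j with rfl | ⟨j', rfl⟩
    · simp
    · simp

/-- `R_r` commutes with scalar maps. [cite: LandsbergManivelRessayre2013, §3.5 (p. 481)] -/
theorem padAt_map {S : Type*} [CommRing S] (f : R →+* S) (r : Fin (m + 1)) (Ω : Matrix (Fin m) (Fin m) R) :
    (padAt r Ω).map f = padAt r (Ω.map f) := by
  ext i j
  rcases Fin.eq_self_or_eq_succAbove r i with rfl | ⟨i', rfl⟩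
  · simp
  · rcases Fin.eq_self_or_eq_succAbove r j with rfl | ⟨j', rfl⟩
    · simp
    · simp

/-- **`adj(R_r Ω) = det(Ω) · E_rr`**: the only non-zero cofactor of the padded matrix is the `(r,r)` one
(every other one has a zero row or column). [cite: LandsbergManivelRessayre2013, §3.5 (p. 481)] -/
theorem adjugate_padAt (r : Fin (m + 1)) (Ω : Matrix (Fin m) (Fin m) R) :
    (padAt r Ω).adjugate = Ω.det • Matrix.single r r (1 : R) := by
  ext i j
  rw [Matrix.adjugate_fin_succ_eq_det_submatrix, Matrix.smul_apply, smul_eq_mul]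
  by_cases hj : j = r
  · subst hj
    by_cases hi : i = j
    · subst hi
      rw [submatrix_padAt, Matrix.single_apply_same, mul_one, ← two_mul, pow_mul, neg_one_sq, one_pow, one_mul]
    · -- column `z` of the submatrix, with `i.succAbove z = j (= r)`, vanishes
      obtain ⟨z, hz⟩ := Fin.exists_succAbove_eq (Ne.symm hi)
      rw [Matrix.single_apply_of_row_ne (Ne.symm hi), mul_zero,
        Matrix.det_eq_zero_of_column_eq_zero z (fun k => by rw [Matrix.submatrix_apply, hz, padAt_apply_right]),
        mul_zero]
  · -- row `z` of the submatrix, with `j.succAbove z = r`, vanishes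
    obtain ⟨z, hz⟩ := Fin.exists_succAbove_eq (Ne.symm hj)
    rw [Matrix.single_apply_of_col_ne _ _ (Ne.symm hj), mul_zero,
      Matrix.det_eq_zero_of_row_eq_zero z (fun k => by rw [Matrix.submatrix_apply, hz, padAt_apply_left]),
      mul_zero]

/-- The line through `R_r(Ω)` restricted to the indices `≠ r` is the line through `Ω`. [cite: LandsbergManivelRessayre2013, §3.5 (p. 481)] -/
theorem submatrix_lineMat_padAt (r : Fin (m + 1)) (Ω : Matrix (Fin m) (Fin m) ℂ)
    (B : Matrix (Fin (m + 1)) (Fin (m + 1)) ℂ) :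
    (lineMat (padAt r Ω) B).submatrix r.succAbove r.succAbove =
      lineMat Ω (B.submatrix r.succAbove r.succAbove) := by
  ext i j
  simp [lineMat_apply]

/-- **JACOBI at the sparse point**: `D(R_r Ω, B)_{rr} = [t¹] det(Ω + tB^{(r)}) = det(Ω) · tr(Ω⁻¹ · B^{(r)})` for
invertible `Ω`, where `B^{(r)} = B.submatrix r.succAbove r.succAbove`. [cite: LandsbergManivelRessayre2013, §3.5 (p. 481)] -/
theorem adjDeriv_padAt_apply_self (r : Fin (m + 1)) {Ω : Matrix (Fin m) (Fin m) ℂ} (hΩ : IsUnit Ω.det)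
    (B : Matrix (Fin (m + 1)) (Fin (m + 1)) ℂ) :
    adjDeriv (padAt r Ω) B r r = Ω.det * Matrix.trace (Ω⁻¹ * B.submatrix r.succAbove r.succAbove) := by
  rw [adjDeriv_apply, Matrix.adjugate_fin_succ_eq_det_submatrix, ← two_mul, pow_mul, neg_one_sq, one_pow, one_mul,
    submatrix_lineMat_padAt]
  set B' := B.submatrix r.succAbove r.succAbove with hB'
  -- `Ω + tB' = Ω · (1 + t Ω⁻¹B')`
  have hfac : lineMat Ω B' = Ω.map (Polynomial.C : ℂ →+* Polynomial ℂ) *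
      (1 + (Polynomial.X : Polynomial ℂ) • (Ω⁻¹ * B').map (Polynomial.C : ℂ →+* Polynomial ℂ)) := by
    rw [Matrix.mul_add, Matrix.mul_one, Matrix.mul_smul, ← Matrix.map_mul, ← Matrix.mul_assoc,
      Matrix.mul_nonsing_inv _ hΩ, Matrix.one_mul]
    rfl
  rw [hfac, Matrix.det_mul, Polynomial.coeff_mul, Finset.Nat.antidiagonal_succ, Finset.sum_cons,
    Finset.Nat.antidiagonal_zero, Finset.map_singleton, Finset.sum_singleton]
  simp only [Function.Embedding.coe_prodMap, Function.Embedding.coeFn_mk, Prod.map_apply, Nat.succ_eq_add_one,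
    zero_add, Function.Embedding.refl_apply]
  have hdet : (Ω.map (Polynomial.C : ℂ →+* Polynomial ℂ)).det = Polynomial.C Ω.det := by
    rw [show Ω.map (Polynomial.C : ℂ →+* Polynomial ℂ) = (Polynomial.C : ℂ →+* Polynomial ℂ).mapMatrix Ω from rfl,
      ← RingHom.map_det]
  rw [hdet, Polynomial.coeff_C_zero, Polynomial.coeff_C, if_neg one_ne_zero, zero_mul, add_zero,
    Matrix.coeff_det_one_add_X_smul_one]

/-- **Off the `r`-th row and column, `D(R_r Ω, B)` vanishes** (odd size, `Ω` invertible skew, `B` skew): row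
`i ≠ r` of `D·R_rΩ = −adj(R_rΩ)·B = −det Ω·E_rr·B` is zero and `Ω` is invertible.
[cite: LandsbergManivelRessayre2013, §3.5 (p. 481)] -/
theorem adjDeriv_padAt_apply_of_ne (hm : Odd (m + 1)) (r : Fin (m + 1)) {Ω : Matrix (Fin m) (Fin m) ℂ}
    (hΩ : Ωᵀ = -Ω) (hΩu : IsUnit Ω.det) {B : Matrix (Fin (m + 1)) (Fin (m + 1)) ℂ} (hB : Bᵀ = -B)
    {i : Fin (m + 1)} (hi : i ≠ r) (k : Fin m) :
    adjDeriv (padAt r Ω) B i (r.succAbove k) = 0 := by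
  have hskew : (padAt r Ω)ᵀ = -padAt r Ω := by
    rw [padAt_transpose, hΩ]
    ext a b
    rcases Fin.eq_self_or_eq_succAbove r a with rfl | ⟨a', rfl⟩
    · simp
    · rcases Fin.eq_self_or_eq_succAbove r b with rfl | ⟨b', rfl⟩
      · simp
      · simp
  have hcard : Odd (Fintype.card (Fin (m + 1))) := by rwa [Fintype.card_fin]
  have h := adjDeriv_mul_eq_neg hcard hskew hB
  rw [adjugate_padAt] at h
  -- row `i` of `D · R_rΩ` vanishes
  have hrow : ∀ j, (adjDeriv (padAt r Ω) B * padAt r Ω) i j = 0 := fun j => by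
    rw [h, Matrix.neg_apply, Matrix.smul_mul, Matrix.smul_apply, Matrix.mul_apply,
      Finset.sum_eq_zero (fun x _ => by rw [Matrix.single_apply_of_row_ne (Ne.symm hi), zero_mul]),
      smul_zero, neg_zero]
  -- hence the vector `k ↦ D i (r.succAbove k)` is killed by `Ω`
  have hvec : (fun k => adjDeriv (padAt r Ω) B i (r.succAbove k)) ᵥ* Ω = 0 := by
    funext j
    have := hrow (r.succAbove j)
    rw [Matrix.mul_apply, Fin.sum_univ_succAbove _ r] at this
    simp only [padAt_apply_left, mul_zero, zero_add, padAt_apply_succAbove] at this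
    simpa [Matrix.vecMul, dotProduct] using this
  have := Matrix.eq_zero_of_vecMul_eq_zero hΩu.ne_zero hvec
  exact congrFun this k

/-- **Row `r` of `D(R_r Ω, B)`**: `(D(R_rΩ,B)_{r,·}|_{≠r}) · Ω = −det(Ω) · B_{r,·}|_{≠r}` (odd size, `Ω` invertible
skew, `B` skew). [cite: LandsbergManivelRessayre2013, §3.5 (p. 481)] -/
theorem adjDeriv_padAt_row_vecMul (hm : Odd (m + 1)) (r : Fin (m + 1)) {Ω : Matrix (Fin m) (Fin m) ℂ}
    (hΩ : Ωᵀ = -Ω) {B : Matrix (Fin (m + 1)) (Fin (m + 1)) ℂ} (hB : Bᵀ = -B) :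
    (fun k => adjDeriv (padAt r Ω) B r (r.succAbove k)) ᵥ* Ω = fun j => -(Ω.det * B r (r.succAbove j)) := by
  have hskew : (padAt r Ω)ᵀ = -padAt r Ω := by
    rw [padAt_transpose, hΩ]
    ext a b
    rcases Fin.eq_self_or_eq_succAbove r a with rfl | ⟨a', rfl⟩
    · simp
    · rcases Fin.eq_self_or_eq_succAbove r b with rfl | ⟨b', rfl⟩
      · simp
      · simp
  have hcard : Odd (Fintype.card (Fin (m + 1))) := by rwa [Fintype.card_fin]
  have h := adjDeriv_mul_eq_neg hcard hskew hB
  rw [adjugate_padAt] at h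
  funext j
  have := congrFun (congrFun h r) (r.succAbove j)
  rw [Matrix.mul_apply, Fin.sum_univ_succAbove _ r, Matrix.neg_apply, Matrix.smul_mul, Matrix.smul_apply,
    Matrix.mul_apply, Fintype.sum_eq_single r (fun x hx => by rw [Matrix.single_apply_of_col_ne _ _ (Ne.symm hx), zero_mul]),
    Matrix.single_apply_same, one_mul, smul_eq_mul] at this
  simp only [padAt_apply_left, mul_zero, zero_add, padAt_apply_succAbove] at this
  simpa [Matrix.vecMul, dotProduct] using this

end SkewAdj

end Literature.Computability.AlgebraicComplexity

end
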